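import Mathlib
import Summits.NavierStokesRegularity.NavierStokesRegularity.Theorems.SubcriticalEnvelopeForwardSourceTailEnvelopeKPPermStrands
import HarnessLib

/-!
# `SubcriticalEnvelope.ForwardSourceTailEnvelopeKP` (stmt-NavierStokesRegularity-27130) — KP
PERMUTATION NETWORKS: the table class (file 2 of 3 of the LEAD-SE rung «uniform KP permutation
networks», `--supports`)

The binders of the KP-class cruxes (27057 / 27130 / 26999) are: `InTableClass R α` (symmetric (4.2),
cancelling (4.3), `R`-comparable), the ORTHANT clause (non-negative nonlinearity at a vanishing mode of
a family non-negative on shells `≥ 1`) and DIAGONAL feed forms.  This file discharges them for the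
permutation networks `kpPermTable σ c`, so that the rung of the sibling file `…KPPerm.lean` is not
vacuous, and records that the two earlier rung classes are instances:

* `kpPermTable_symmetric`, `kpPermTable_cancelling`, `kpPermTable_comparable`,
  `kpPermTable_inTableClass` — `kpPermTable σ c ∈ E₂(R)` when the non-zero `c a` lie in `[2/R, 1]`
  in modulus;
* `kpPermTable_diagonal` — KP proper; `kpPermTable_orthant` — orthant when `c ≥ 0` (with
  `kpPerm_coeff_nonneg_of_orthant` of the sibling file: orthant iff `c ≥ 0`);
* `kpPermTable_one_eq_dyadic` — `kpPermTable 1 (c·e₀) = c·dyadicTable` (the one-mode chain);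
* `kpPermTable_swap_eq_twoCycle` — `kpPermTable (swap 0 1) (c₀, c₁, 0, 0) = kpTwoCycleTable c₀ c₁`
  (the 2-cycle of the previous rung, asymmetric coefficients included).

HONEST FRAMING: algebra about Tao-type MODEL lattice tables (rung TL-M2Break); no crux is proved;
nothing here concerns the Navier–Stokes equations; NS regularity is NOT advanced.
-/

noncomputable section

-- the sub-problem namespace `NavierStokesRegularity.NavierStokesRegularity` is the tree's layout (D-0017)
set_option linter.dupNamespace false

namespace Summit.NavierStokesRegularity.NavierStokesRegularity.Theorems

open Set
open Literature.Analysis.FluidPDE.TaoCascade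

/-! ## §9 The class: table conditions, and the earlier rungs as instances -/

/-- The permutation network is symmetric (4.2). [this file] -/
theorem kpPermTable_symmetric (σ : Equiv.Perm (Fin 4)) (c : Fin 4 → ℝ) :
    IsSymmetricCoeff (kpPermTable σ c) := by
  intro i₁ i₂ i₃ μ₁ μ₂ μ₃ hμ
  rw [mem_shiftSet_iff] at hμ
  rcases hμ with h | h | h | h <;> simp only [Prod.mk.injEq] at h <;> obtain ⟨rfl, rfl, rfl⟩ := h
  · rw [kpPermTable_inshell, kpPermTable_inshell]
  · rw [kpPermTable_up1, kpPermTable_up2]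
  · rw [kpPermTable_up2, kpPermTable_up1]
  · rw [kpPermTable_feed, kpPermTable_feed]
    by_cases h : i₁ = i₂ ∧ i₃ = σ i₁
    · obtain ⟨rfl, h2⟩ := h
      simp [h2]
    · rw [if_neg h, if_neg]
      rintro ⟨rfl, h2⟩
      exact h ⟨rfl, h2⟩

/-- The permutation network is cancelling (4.3): on each shift orbit the six structure constants
are `c, c, −c/2, −c/2, −c/2, −c/2` when the indices are pinned to one Katz–Pavlović pair and all
vanish otherwise. [this file] -/
theorem kpPermTable_cancelling (σ : Equiv.Perm (Fin 4)) (c : Fin 4 → ℝ) :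
    IsCancellingCoeff (kpPermTable σ c) := by
  intro i₁ i₂ i₃ μ₁ μ₂ μ₃ hμ
  rw [mem_shiftSet_iff] at hμ
  rcases hμ with h | h | h | h <;> simp only [Prod.mk.injEq] at h <;> obtain ⟨rfl, rfl, rfl⟩ := h <;>
    simp only [kpPermTable_inshell, kpPermTable_up1, kpPermTable_up2, kpPermTable_feed]
  · norm_num
  · -- μ = (1,0,0): pinned iff `i₃ = i₂ ∧ i₁ = σ i₂`
    by_cases hP : i₃ = i₂ ∧ i₁ = σ i₂
    · obtain ⟨rfl, rfl⟩ := hP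
      simp only [and_self, if_true]
      ring
    · have n1 : ¬(i₁ = σ i₂ ∧ i₃ = i₂) := fun h => hP ⟨h.2, h.1⟩
      have n2 : ¬(i₁ = σ i₃ ∧ i₂ = i₃) := fun h => hP ⟨h.2.symm, by rw [h.2]; exact h.1⟩
      have n3 : ¬(i₂ = i₃ ∧ i₁ = σ i₂) := fun h => hP ⟨h.1.symm, h.2⟩
      have n4 : ¬(i₃ = i₂ ∧ i₁ = σ i₃) := fun h => hP ⟨h.1, by rw [← h.1]; exact h.2⟩
      simp [n1, n2, n3, n4]
  · -- μ = (0,1,0): pinned iff `i₃ = i₁ ∧ i₂ = σ i₁`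
    by_cases hP : i₃ = i₁ ∧ i₂ = σ i₁
    · obtain ⟨rfl, rfl⟩ := hP
      simp only [and_self, if_true]
      ring
    · have n1 : ¬(i₂ = σ i₁ ∧ i₃ = i₁) := fun h => hP ⟨h.2, h.1⟩
      have n2 : ¬(i₁ = i₃ ∧ i₂ = σ i₁) := fun h => hP ⟨h.1.symm, h.2⟩
      have n3 : ¬(i₂ = σ i₃ ∧ i₁ = i₃) := fun h => hP ⟨h.2.symm, by rw [h.2]; exact h.1⟩
      have n4 : ¬(i₃ = i₁ ∧ i₂ = σ i₃) := fun h => hP ⟨h.1, by rw [← h.1]; exact h.2⟩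
      simp [n1, n2, n3, n4]
  · -- μ = (0,0,1): pinned iff `i₂ = i₁ ∧ i₃ = σ i₁`
    by_cases hP : i₂ = i₁ ∧ i₃ = σ i₁
    · obtain ⟨rfl, rfl⟩ := hP
      simp only [and_self, if_true]
      ring
    · have n1 : ¬(i₁ = i₂ ∧ i₃ = σ i₁) := fun h => hP ⟨h.1.symm, h.2⟩
      have n2 : ¬(i₃ = σ i₁ ∧ i₂ = i₁) := fun h => hP ⟨h.2, h.1⟩
      have n3 : ¬(i₂ = i₁ ∧ i₃ = σ i₂) := fun h => hP ⟨h.1, by rw [← h.1]; exact h.2⟩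
      have n4 : ¬(i₃ = σ i₂ ∧ i₁ = i₂) := fun h => hP ⟨h.2.symm, by rw [h.2]; exact h.1⟩
      simp [n1, n2, n3, n4]

/-- The permutation network is `R`-comparable iff every non-zero coefficient lies in `[2/R, 1]` in
modulus; here the «if» direction. [this file] -/
theorem kpPermTable_comparable {σ : Equiv.Perm (Fin 4)} {c : Fin 4 → ℝ} {R : ℝ} (hR : 0 < R)
    (hc : ∀ a, c a = 0 ∨ (2 / R ≤ |c a| ∧ |c a| ≤ 1)) :
    IsComparableCoeff R (kpPermTable σ c) := by
  have key : ∀ a : Fin 4, (|c a| ≤ 1 ∧ (c a = 0 ∨ R⁻¹ ≤ |c a|)) ∧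
      (|-(c a / 2)| ≤ 1 ∧ (-(c a / 2) = 0 ∨ R⁻¹ ≤ |-(c a / 2)|)) := by
    intro a
    have hR1 : R⁻¹ ≤ 2 / R := by rw [inv_eq_one_div]; exact div_le_div_of_nonneg_right (by norm_num) hR.le
    rcases hc a with h | ⟨h1, h2⟩
    · simp [h]
    · refine ⟨⟨h2, Or.inr (hR1.trans h1)⟩, ?_, Or.inr ?_⟩
      · rw [abs_neg, abs_div, abs_two]; linarith
      · rw [abs_neg, abs_div, abs_two]
        have : 2 / R / 2 = R⁻¹ := by rw [inv_eq_one_div]; ring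
        linarith [div_le_div_of_nonneg_right h1 (by norm_num : (0:ℝ) ≤ 2)]
  intro i₁ i₂ i₃ μ hμ
  rw [mem_shiftSet_iff] at hμ
  rcases hμ with rfl | rfl | rfl | rfl
  · rw [kpPermTable_inshell]; simp
  · rw [kpPermTable_up1]; split_ifs
    · exact (key i₂).2
    · simp
  · rw [kpPermTable_up2]; split_ifs
    · exact (key i₁).2
    · simp
  · rw [kpPermTable_feed]; split_ifs
    · exact (key i₁).1
    · simp

/-- **The uniform KP permutation networks lie in `E₂(R)`** as soon as the non-zero coefficients lie
in `[2/R, 1]` in modulus. [this file] -/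
theorem kpPermTable_inTableClass {σ : Equiv.Perm (Fin 4)} {c : Fin 4 → ℝ} {R : ℝ} (hR : 0 < R)
    (hc : ∀ a, c a = 0 ∨ (2 / R ≤ |c a| ∧ |c a| ≤ 1)) : InTableClass R (kpPermTable σ c) :=
  ⟨kpPermTable_symmetric σ c, kpPermTable_cancelling σ c, kpPermTable_comparable hR hc⟩

/-- **The permutation network has DIAGONAL feed forms** (KP proper): `α a b i (0,0,1) = 0` for
`a ≠ b`. [this file] -/
theorem kpPermTable_diagonal (σ : Equiv.Perm (Fin 4)) (c : Fin 4 → ℝ) :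
    ∀ a b i : Fin 4, a ≠ b → kpPermTable σ c a b i (0, 0, 1) = 0 := by
  intro a b i hab
  rw [kpPermTable_feed, if_neg]
  exact fun h => hab h.1

/-- **The permutation network is ORTHANT when `c ≥ 0`**: at a vanishing mode of a family that is
non-negative on shells `≥ 1`, the nonlinearity reduces to the feed `c(σ⁻¹ i)·(1+δ)^{5(n-1)/2}·Y² ≥ 0`
(the predecessor sits on shell `n − 1 ≥ 0`; on shell `0` the square makes the sign irrelevant).
[this file] -/
theorem kpPermTable_orthant {σ : Equiv.Perm (Fin 4)} {c : Fin 4 → ℝ} (hc : ∀ a, 0 ≤ c a) :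
    ∀ (Y : Fin 4 → ℤ → ℝ → ℝ) (τ : ℝ), (∀ (j : Fin 4) (k : ℤ), 1 ≤ k → 0 ≤ Y j k τ) →
      ∀ δ : ℝ, 0 < δ → ∀ (i : Fin 4) (n : ℤ), 1 ≤ n → Y i n τ = 0 →
      0 ≤ quadTerm δ (kpPermTable σ c) Y i n τ := by
  intro Y τ _hY δ hδ i n _hn h0
  rw [quadTerm_kpPerm, h0, zero_mul, mul_zero, mul_zero, sub_zero]
  have : (0 : ℝ) ≤ (1 + δ) ^ ((5 : ℝ) * (n - 1) / 2) := Real.rpow_nonneg (by linarith) _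
  exact mul_nonneg (hc _) (mul_nonneg this (sq_nonneg _))

/-- **The one-mode chain is the permutation network of the identity** with coefficient vector
`c·e₀`: `kpPermTable 1 (c·e₀) = c·dyadicTable`. [this file] -/
theorem kpPermTable_one_eq_dyadic (c : ℝ) :
    kpPermTable 1 (fun a => if a = 0 then c else 0) = fun i₁ i₂ i₃ μ => c * dyadicTable i₁ i₂ i₃ μ := by
  funext i₁ i₂ i₃ μ
  simp only [kpPermTable, dyadicTable, Equiv.Perm.one_apply]
  by_cases h1 : μ = ((0 : ℤ), (0 : ℤ), (1 : ℤ))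
  · subst h1
    fin_cases i₁ <;> fin_cases i₂ <;> fin_cases i₃ <;> simp
  by_cases h2 : μ = ((1 : ℤ), (0 : ℤ), (0 : ℤ))
  · subst h2
    fin_cases i₁ <;> fin_cases i₂ <;> fin_cases i₃ <;> simp [div_eq_mul_inv]
  by_cases h3 : μ = ((0 : ℤ), (1 : ℤ), (0 : ℤ))
  · subst h3
    fin_cases i₁ <;> fin_cases i₂ <;> fin_cases i₃ <;> simp [div_eq_mul_inv]
  simp [h1, h2, h3]

/-- **The 2-cycle of the previous rung is the permutation network of `swap 0 1`** with coefficient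
vector `(c₀, c₁, 0, 0)`: `kpPermTable (swap 0 1) (c₀, c₁, 0, 0) = kpTwoCycleTable c₀ c₁` (general,
possibly asymmetric, coefficients). [this file] -/
theorem kpPermTable_swap_eq_twoCycle (c₀ c₁ : ℝ) :
    kpPermTable (Equiv.swap 0 1) (fun a => if a = 0 then c₀ else if a = 1 then c₁ else 0) =
      kpTwoCycleTable c₀ c₁ := by
  funext i₁ i₂ i₃ μ
  simp only [kpPermTable, kpTwoCycleTable]
  by_cases h1 : μ = ((0 : ℤ), (0 : ℤ), (1 : ℤ))
  · subst h1
    fin_cases i₁ <;> fin_cases i₂ <;> fin_cases i₃ <;> simp [Equiv.swap_apply_def]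
  by_cases h2 : μ = ((1 : ℤ), (0 : ℤ), (0 : ℤ))
  · subst h2
    fin_cases i₁ <;> fin_cases i₂ <;> fin_cases i₃ <;> simp [Equiv.swap_apply_def]
  by_cases h3 : μ = ((0 : ℤ), (1 : ℤ), (0 : ℤ))
  · subst h3
    fin_cases i₁ <;> fin_cases i₂ <;> fin_cases i₃ <;> simp [Equiv.swap_apply_def]
  simp [h1, h2, h3]

end Summit.NavierStokesRegularity.NavierStokesRegularity.Theorems

end
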